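import Mathlib
import Literature.NumberTheory.Sieve.LinearEquationsInPrimesOneForm
import Literature.NumberTheory.LFunctions.PrimeNumberTheoremProgressions
import Literature.NumberTheory.Sieve.PolymathGEHPieces

/-!
# Crux `PairsToGHL` (stmt-Parity-9389), line `sloped_ladder`: stub `stub_singles` (the base `t = 1`)

For ONE positive affine-linear form `ψ(n) = a n + b` on `ℤ` (`a ≥ 1`, `b ≥ 0`):
`∑_{1 ≤ n ≤ N} Λ(a n + b) = 𝔖 · N + o(N)` with `𝔖 = singularProduct (ψ) = 𝟙[gcd(a,b) = 1] · a/φ(a)`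
— the prime number theorem in the progression `b (mod a)` together with the local-factor computation
for one sloped form.  Ingredients (all proved in the tree):

* `Literature.NumberTheory.Sieve.OneForm.singularProduct_eq` — the singular product of one form is
  `𝟙[gcd(a,b) = 1] · |a|/φ(|a|)` (Green–Tao 2010, (1.6)–(1.7));
* the sampling identity `∑_{n ≤ N} Λ(a n + b) = ψ(aN + b; a, b) − ψ(b; a, b)`
  (`sum_vonMangoldt_linear_eq`, by induction on `N`: between `aN + b` and `a(N+1) + b` exactly the
  top integer lies in the class `b mod a`);
* coprime case: the prime number theorem for the progression `b (mod a)` along the integers,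
  `Literature.NumberTheory.LFunctions.vonMangoldt_residueClass_sum_isLittleO` (Wiener–Ikehara);
* non-coprime case: a prime `p ∣ gcd(a, b)` divides every `a n + b`, and
  `∑_{m ≤ y, p ∣ m} Λ(m) ≤ log y` (`Literature.NumberTheory.Sieve.sum_vonMangoldt_filter_dvd_le_log`),
  so the sum is `O(log N) = o(N)` while `𝔖 = 0`.
-/

namespace Summit.Parity.GeneralizedHardyLittlewood.Theorems.PairsToGHL.SlopedLadder

open Filter Finset Asymptotics
open scoped ArithmeticFunction.vonMangoldt

/-! ### The sampling identity along a progression -/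

/-- One step of the sampling identity: among `M < m ≤ M + a` exactly `m = M + a` lies in the class
of `M` modulo `a`, so `∑_{M < m ≤ M + a} Λ|_{M mod a}(m) = Λ(M + a)` (`a ≥ 1`). [folklore] -/
theorem sum_Ioc_residueClass_step {a : ℕ} (ha : 0 < a) (M : ℕ) :
    ∑ m ∈ Ioc M (M + a), ArithmeticFunction.vonMangoldt.residueClass (M : ZMod a) m =
      Λ (M + a) := by
  -- adapted from `Summit.Parity.BatemanHorn.Theorems.PolyMobiusTail.NaturalForm.DegreeOne`
  have hsplit : ∑ m ∈ Ioc M (M + a), ArithmeticFunction.vonMangoldt.residueClass (M : ZMod a) m =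
      ∑ m ∈ Ioc M (M + a - 1), ArithmeticFunction.vonMangoldt.residueClass (M : ZMod a) m +
        ArithmeticFunction.vonMangoldt.residueClass (M : ZMod a) (M + a - 1 + 1) := by
    rw [← Finset.sum_Ioc_succ_top (by omega : M ≤ M + a - 1)]
    rw [show M + a - 1 + 1 = M + a by omega]
  -- the intermediate terms vanish: `0 < m - M < a` is incompatible with `m ≡ M (mod a)`
  have hmid : ∑ m ∈ Ioc M (M + a - 1),
      ArithmeticFunction.vonMangoldt.residueClass (M : ZMod a) m = 0 := by
    refine Finset.sum_eq_zero fun m hm => ?_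
    obtain ⟨hm1, hm2⟩ := Finset.mem_Ioc.mp hm
    simp only [ArithmeticFunction.vonMangoldt.residueClass, Set.indicator_apply_eq_zero,
      Set.mem_setOf_eq]
    intro hma
    exfalso
    have hmod : M ≡ m [MOD a] := ((ZMod.natCast_eq_natCast_iff m M a).mp hma).symm
    have hdvd : a ∣ m - M := (Nat.modEq_iff_dvd' hm1.le).mp hmod
    have hle : a ≤ m - M := Nat.le_of_dvd (by omega) hdvd
    omega
  -- the top term is `Λ(M + a)` since `M + a ≡ M (mod a)`
  have htop : ArithmeticFunction.vonMangoldt.residueClass (M : ZMod a) (M + a - 1 + 1) = Λ (M + a) := by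
    rw [show M + a - 1 + 1 = M + a by omega]
    simp only [ArithmeticFunction.vonMangoldt.residueClass, Set.indicator_apply, Set.mem_setOf_eq]
    rw [if_pos]
    push_cast
    rw [ZMod.natCast_self, add_zero]
  rw [hsplit, hmid, zero_add, htop]

/-- **Sampling identity.** For `a ≥ 1` and all `b, N`:
`∑_{1 ≤ n ≤ N} Λ(a n + b) = ψ(aN + b; a, b) − ψ(b; a, b)` where
`ψ(X; a, b) = ∑_{1 ≤ m ≤ X, m ≡ b (a)} Λ(m)` — the integers `m ≡ b (mod a)` with `b < m ≤ aN + b`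
are exactly the `a n + b`, `1 ≤ n ≤ N`. [folklore] -/
theorem sum_vonMangoldt_linear_eq {a : ℕ} (ha : 0 < a) (b N : ℕ) :
    ∑ n ∈ Icc 1 N, Λ (a * n + b) =
      ∑ m ∈ Icc 1 (a * N + b), ArithmeticFunction.vonMangoldt.residueClass (b : ZMod a) m -
        ∑ m ∈ Icc 1 b, ArithmeticFunction.vonMangoldt.residueClass (b : ZMod a) m := by
  induction N with
  | zero => simp
  | succ N ih =>
    rw [Finset.sum_Icc_succ_top (Nat.le_add_left 1 N), ih]
    have hmono : a * N + b ≤ a * (N + 1) + b := by nlinarith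
    have hIcc : ∀ X : ℕ, Icc 1 X = Ioc 0 X := fun X => rfl
    have hstep := sum_Ioc_residueClass_step ha (a * N + b)
    have hcast : ((a * N + b : ℕ) : ZMod a) = (b : ZMod a) := by
      push_cast
      rw [ZMod.natCast_self, zero_mul, zero_add]
    rw [hcast, show a * N + b + a = a * (N + 1) + b by ring] at hstep
    simp only [hIcc]
    rw [← Finset.sum_Ioc_consecutive _ (Nat.zero_le (a * N + b)) hmono, hstep]
    ring

/-! ### The coprime case: the prime number theorem in the progression `b (mod a)` -/

/-- For `a ≥ 1` and `gcd(a, b) = 1`: `∑_{1 ≤ n ≤ N} Λ(a n + b) − (a/φ(a)) N = o(N)` — the prime number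
theorem for the progression `b (mod a)` (tree: `vonMangoldt_residueClass_sum_isLittleO`, Wiener–Ikehara;
Montgomery–Vaughan Cor. 11.17 main term) transported through the sampling identity along
`N ↦ aN + b`. [folklore] -/
theorem isLittleO_sum_vonMangoldt_linear_of_coprime {a b : ℕ} (ha : 0 < a) (hab : Nat.Coprime b a) :
    (fun N : ℕ => ∑ n ∈ Icc 1 N, Λ (a * n + b) - (a : ℝ) / Nat.totient a * N) =o[atTop]
      fun N : ℕ => (N : ℝ) := by
  -- adapted from `Summit.Parity.BatemanHorn.Theorems.PolyMobiusTail.NaturalForm.DegreeOne`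
  haveI : NeZero a := ⟨ha.ne'⟩
  have hu : IsUnit ((b : ℕ) : ZMod a) := (ZMod.isUnit_iff_coprime b a).mpr hab
  set T : ℕ → ℕ := fun N => a * N + b with hT
  set ψ : ℕ → ℝ := fun X =>
    ∑ m ∈ Icc 1 X, ArithmeticFunction.vonMangoldt.residueClass (b : ZMod a) m with hψ
  have hTge : ∀ N : ℕ, N ≤ T N := fun N => by
    simp only [hT]
    nlinarith
  have hTtop : Tendsto T atTop atTop := tendsto_atTop_mono hTge tendsto_id
  -- PNT in the progression along `T N → ∞`
  have h1 : (fun N : ℕ => ψ (T N) - (Nat.totient a : ℝ)⁻¹ * ((T N : ℕ) : ℝ)) =o[atTop]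
      fun N : ℕ => ((T N : ℕ) : ℝ) :=
    (Literature.NumberTheory.LFunctions.vonMangoldt_residueClass_sum_isLittleO hu).comp_tendsto hTtop
  -- `T N = O(N)`
  have h2 : (fun N : ℕ => ((T N : ℕ) : ℝ)) =O[atTop] fun N : ℕ => (N : ℝ) := by
    refine IsBigO.of_bound ((a : ℝ) + b) ?_
    filter_upwards [eventually_ge_atTop 1] with N hN
    rw [Real.norm_eq_abs, Real.norm_eq_abs, abs_of_nonneg (Nat.cast_nonneg _),
      abs_of_nonneg (Nat.cast_nonneg _)]
    have hN1 : (1 : ℝ) ≤ N := by exact_mod_cast hN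
    simp only [hT]
    push_cast
    nlinarith [(Nat.cast_nonneg b : (0 : ℝ) ≤ b)]
  -- the two main terms differ by the constant `b/φ(a)`
  have h3 : (fun N : ℕ => (Nat.totient a : ℝ)⁻¹ * ((T N : ℕ) : ℝ) - (a : ℝ) / Nat.totient a * N) =o[atTop]
      fun N : ℕ => (N : ℝ) := by
    have hc : (fun _ : ℕ => (Nat.totient a : ℝ)⁻¹ * (b : ℝ)) =o[atTop] fun N : ℕ => (N : ℝ) := by
      refine isLittleO_const_left.mpr (Or.inr ?_)
      exact tendsto_norm_atTop_atTop.comp tendsto_natCast_atTop_atTop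
    refine hc.congr' (Eventually.of_forall fun N => ?_) EventuallyEq.rfl
    simp only [hT]
    push_cast
    ring
  -- the constant `ψ(b; a, b)`
  have h4 : (fun _ : ℕ => ψ b) =o[atTop] fun N : ℕ => (N : ℝ) := by
    refine isLittleO_const_left.mpr (Or.inr ?_)
    exact tendsto_norm_atTop_atTop.comp tendsto_natCast_atTop_atTop
  -- assemble through the sampling identity
  have hsum := ((h1.trans_isBigO h2).add h3).sub h4
  refine hsum.congr' (Eventually.of_forall fun N => ?_) EventuallyEq.rfl
  simp only [hψ, hT]
  rw [sum_vonMangoldt_linear_eq ha b N]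
  ring

/-! ### The non-coprime case: `O(log N)` -/

/-- For `a ≥ 1` and `gcd(a, b) > 1`: a prime `p ∣ gcd(a, b)` divides every `a n + b`, the map
`n ↦ a n + b` is injective, and `∑_{m ≤ aN + b, p ∣ m} Λ(m) ≤ log(aN + b)`; hence
`0 ≤ ∑_{1 ≤ n ≤ N} Λ(a n + b) ≤ log(aN + b)` for `N ≥ 1`. [folklore] -/
theorem sum_vonMangoldt_linear_le_log_of_not_coprime {a b : ℕ} (ha : 0 < a) (hab : ¬ Nat.Coprime b a)
    {N : ℕ} (hN : 1 ≤ N) :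
    ∑ n ∈ Icc 1 N, Λ (a * n + b) ≤ Real.log ((a * N + b : ℕ) : ℝ) := by
  have hg : Nat.gcd b a ≠ 1 := fun h => hab (Nat.coprime_iff_gcd_eq_one.mp h)
  set p : ℕ := (Nat.gcd b a).minFac with hp
  have hpp : p.Prime := Nat.minFac_prime hg
  have hpb : p ∣ b := (Nat.minFac_dvd _).trans (Nat.gcd_dvd_left b a)
  have hpa : p ∣ a := (Nat.minFac_dvd _).trans (Nat.gcd_dvd_right b a)
  calc ∑ n ∈ Icc 1 N, Λ (a * n + b)
      = ∑ m ∈ (Icc 1 N).image (fun n => a * n + b), Λ m := by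
        rw [Finset.sum_image]
        intro x _ y _ hxy
        have hxy' : a * x + b = a * y + b := hxy
        exact Nat.eq_of_mul_eq_mul_left ha (Nat.add_right_cancel hxy')
    _ ≤ ∑ m ∈ (Icc 1 (a * N + b)).filter (fun m => p ∣ m), Λ m := by
        refine Finset.sum_le_sum_of_subset_of_nonneg ?_ fun _ _ _ =>
          ArithmeticFunction.vonMangoldt_nonneg
        intro m hm
        simp only [Finset.mem_image, Finset.mem_Icc] at hm
        obtain ⟨n, ⟨hn1, hnN⟩, rfl⟩ := hm
        simp only [Finset.mem_filter, Finset.mem_Icc]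
        refine ⟨⟨?_, ?_⟩, (Dvd.dvd.mul_right hpa n).add hpb⟩
        · nlinarith
        · nlinarith
    _ ≤ Real.log ((a * N + b : ℕ) : ℝ) :=
        Literature.NumberTheory.Sieve.sum_vonMangoldt_filter_dvd_le_log hpp (by nlinarith)

/-- For `a ≥ 1` and `gcd(a, b) > 1`: `∑_{1 ≤ n ≤ N} Λ(a n + b) = O(log N) = o(N)`. [folklore] -/
theorem isLittleO_sum_vonMangoldt_linear_of_not_coprime {a b : ℕ} (ha : 0 < a)
    (hab : ¬ Nat.Coprime b a) :
    (fun N : ℕ => ∑ n ∈ Icc 1 N, Λ (a * n + b)) =o[atTop] fun N : ℕ => (N : ℝ) := by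
  set T : ℕ → ℕ := fun N => a * N + b with hT
  have hTge : ∀ N : ℕ, N ≤ T N := fun N => by
    simp only [hT]
    nlinarith
  have hTtop : Tendsto (fun N : ℕ => ((T N : ℕ) : ℝ)) atTop atTop :=
    tendsto_natCast_atTop_atTop.comp (tendsto_atTop_mono hTge tendsto_id)
  -- `T N = O(N)`
  have h2 : (fun N : ℕ => ((T N : ℕ) : ℝ)) =O[atTop] fun N : ℕ => (N : ℝ) := by
    refine IsBigO.of_bound ((a : ℝ) + b) ?_
    filter_upwards [eventually_ge_atTop 1] with N hN
    rw [Real.norm_eq_abs, Real.norm_eq_abs, abs_of_nonneg (Nat.cast_nonneg _),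
      abs_of_nonneg (Nat.cast_nonneg _)]
    have hN1 : (1 : ℝ) ≤ N := by exact_mod_cast hN
    simp only [hT]
    push_cast
    nlinarith [(Nat.cast_nonneg b : (0 : ℝ) ≤ b)]
  -- `log (T N) = o(T N) = o(N)`
  have hlog : (fun N : ℕ => Real.log ((T N : ℕ) : ℝ)) =o[atTop] fun N : ℕ => (N : ℝ) :=
    (Real.isLittleO_log_id_atTop.comp_tendsto hTtop).trans_isBigO h2
  refine (IsBigO.of_bound 1 ?_).trans_isLittleO hlog
  filter_upwards [eventually_ge_atTop 1] with N hN
  rw [Real.norm_eq_abs, Real.norm_eq_abs, one_mul,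
    abs_of_nonneg (Finset.sum_nonneg fun _ _ => ArithmeticFunction.vonMangoldt_nonneg)]
  exact (sum_vonMangoldt_linear_le_log_of_not_coprime ha hab hN).trans (le_abs_self _)

/-! ### The stub -/

/-- **`stub_singles` — base `t = 1` of the sloped ladder** (line `sloped_ladder` of the crux `PairsToGHL`,
stmt-Parity-9389): for every single positive form `ψ(n) = a n + b` (`a ≥ 1`, `b ≥ 0`),
`∑_{1 ≤ n ≤ N} Λ(a n + b) = 𝔖 · N + o(N)` with `𝔖 = singularProduct (ψ) = 𝟙[gcd(a,b) = 1] · a/φ(a)`.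
Proof: `OneForm.singularProduct_eq` for the constant; the prime number theorem in the progression
`b (mod a)` (`isLittleO_sum_vonMangoldt_linear_of_coprime`) when `gcd(a, b) = 1`, and the trivial bound
`O(log N)` (`isLittleO_sum_vonMangoldt_linear_of_not_coprime`) when `gcd(a, b) > 1`.
[cite: GreenTao2010, (1.6)–(1.7)] -/
theorem stub_singles :
    ∀ Φ : Fin 1 → Literature.NumberTheory.Sieve.AffLinForm 1, Literature.NumberTheory.Sieve.IsNondegenerateSystem Φ → (∀ i, 0 < (Φ i).coeff 0 ∧ 0 ≤ (Φ i).const) → ((fun N : ℕ => ∑ n ∈ Finset.Icc 1 N, ∏ i, Literature.NumberTheory.Sieve.intVonMangoldt ((Φ i).eval ![(n : ℤ)]) - Literature.NumberTheory.Sieve.singularProduct Φ * N) =o[Filter.atTop] fun N : ℕ => (N : ℝ)) := by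
  intro Φ _hΦ hpos
  obtain ⟨hA, hB⟩ := hpos 0
  obtain ⟨a, ha⟩ : ∃ a : ℕ, (Φ 0).coeff 0 = a :=
    ⟨((Φ 0).coeff 0).toNat, (Int.toNat_of_nonneg hA.le).symm⟩
  obtain ⟨b, hb⟩ : ∃ b : ℕ, (Φ 0).const = b := ⟨((Φ 0).const).toNat, (Int.toNat_of_nonneg hB).symm⟩
  have ha0 : 0 < a := by
    rw [ha] at hA
    exact_mod_cast hA
  -- the summand is `Λ(a n + b)`
  have hsummand : ∀ n : ℕ,
      ∏ i, Literature.NumberTheory.Sieve.intVonMangoldt ((Φ i).eval ![(n : ℤ)]) = Λ (a * n + b) := by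
    intro n
    rw [Fin.prod_univ_one]
    simp only [Literature.NumberTheory.Sieve.intVonMangoldt, Literature.NumberTheory.Sieve.AffLinForm.eval,
      Fin.sum_univ_one, Matrix.cons_val_zero, ha, hb]
    rw [show (a : ℤ) * (n : ℤ) + (b : ℤ) = ((a * n + b : ℕ) : ℤ) by push_cast; ring, Int.toNat_natCast]
  -- the singular product is `𝟙[gcd(a,b) = 1] · a/φ(a)`
  have hS : Literature.NumberTheory.Sieve.singularProduct Φ =
      if Nat.gcd b a = 1 then (a : ℝ) / Nat.totient a else 0 := by
    have hne : (Φ 0).coeff 0 ≠ 0 := by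
      rw [ha]
      exact_mod_cast ha0.ne'
    rw [Literature.NumberTheory.Sieve.OneForm.singularProduct_eq Φ hne, ha, hb, Int.gcd_natCast_natCast,
      Int.natAbs_natCast, Nat.gcd_comm]
  by_cases hcop : Nat.Coprime b a
  · have hS' : Literature.NumberTheory.Sieve.singularProduct Φ = (a : ℝ) / Nat.totient a := by
      rw [hS, if_pos (Nat.coprime_iff_gcd_eq_one.mpr hcop)]
    refine (isLittleO_sum_vonMangoldt_linear_of_coprime ha0 hcop).congr'
      (Eventually.of_forall fun N => ?_) EventuallyEq.rfl
    simp only [hsummand, hS']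
  · have hS' : Literature.NumberTheory.Sieve.singularProduct Φ = 0 := by
      rw [hS, if_neg (fun h => hcop (Nat.coprime_iff_gcd_eq_one.mp h))]
    refine (isLittleO_sum_vonMangoldt_linear_of_not_coprime ha0 hcop).congr'
      (Eventually.of_forall fun N => ?_) EventuallyEq.rfl
    simp only [hsummand, hS', zero_mul, sub_zero]

end Summit.Parity.GeneralizedHardyLittlewood.Theorems.PairsToGHL.SlopedLadder
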